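import Mathlib
import HarnessLib
import Literature.AlgebraicGeometry.Resolution.BlowupPrincipalCharts
import Literature.AlgebraicGeometry.Resolution.MarkedIdealsLemmas

/-!
# S1a — (S3) STABILITY of the principal charts of a blow-up under compatible automorphisms

[OURS · L1 W4.5c · lead-1 g6] — NOT a statement of the manuscript; counted 0; AI-level work, weaker than expert
review. Crux stmt-ResolutionOfSingularities-17941 (`WildQuotients.CyclicQuotientFourfolds`), line `s1a-logminvertex`,
stub `stub_localGame` (producer); A5b design `Cruxes/CyclicQuotientFourfolds/Lines/s1a-logminvertex-A5B-DESIGN.md`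
(S3) «stability + intertwining of the lifted action», plan-1 RULING 22:26:15Z. The treeʼs INTRINSIC principal
chart `blowupChart π I U b` (`Literature/…/BlowupPrincipalCharts.lean`: the union of the affine opens `W ≤ π⁻¹ U` on
which `π^* b` is a nonzerodivisor generating `I·𝒪_{X'}(W)`; for a blow-up it is `D₊(b t)`) is preserved by every
automorphism `θ'` of `X'` covering an automorphism `θ` of `X` that fixes `U`, `I` and the section `b`:

* `IsPrincipalChart.preimage` — principal charts transport along `θ'⁻¹`;
* **`preimage_blowupChart_eq`** — `θ'.hom ⁻¹ᵁ blowupChart π I U b = blowupChart π I U b`.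
Applied (next file) with `θ' = (liftActionOver ρ hπ hρ).aut g`, `θ = ρ.aut g`, `U` a centre chart and `b` a
σ-invariant normalised cover element, this is the `G`-stability of the new node charts.
-/

set_option linter.dupNamespace false

noncomputable section

open CategoryTheory AlgebraicGeometry TopologicalSpace
open Literature.AlgebraicGeometry.Resolution

namespace Summit.ResolutionOfSingularities.ResolutionOfSingularities.Theorems.WildQuotientResolution.S1.BlowupCharts

universe u

variable {X' X : Scheme.{u}} {π : X' ⟶ X} {I : X.IdealSheafData} {U : X.affineOpens} {b : Γ(X, U)}

/-- Equal morphisms have equal `appLE` (the inequality proofs are irrelevant). -/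
theorem appLE_congr_of_eq {Y Z : Scheme.{u}} {φ ψ : Y ⟶ Z} (h : φ = ψ) (V : Z.Opens) (W : Y.Opens)
    (e₁ : W ≤ φ ⁻¹ᵁ V) (e₂ : W ≤ ψ ⁻¹ᵁ V) : φ.appLE V W e₁ = ψ.appLE V W e₂ := by
  subst h; rfl

/-- The identity acts trivially on sections (`appLE` form). -/
theorem id_appLE_apply {Y : Scheme.{u}} (V : Y.Opens) (e : V ≤ (𝟙 Y) ⁻¹ᵁ V) (s : Γ(Y, V)) :
    (𝟙 Y : Y ⟶ Y).appLE V V e s = s := by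
  have h1 : (𝟙 Y : Y ⟶ Y).appLE V V e = Y.presheaf.map (homOfLE e).op := by
    rw [Scheme.Hom.appLE, Scheme.Hom.id_app]
    erw [Category.id_comp]
  have h2 : (homOfLE e).op = 𝟙 (Opposite.op V) := Subsingleton.elim _ _
  have h3 : Y.presheaf.map (homOfLE e).op = 𝟙 _ := by rw [h2]; exact Y.presheaf.map_id _
  rw [h1, h3]
  rfl

/-- **Principal charts transport along a compatible automorphism**: if `ψ' ≫ π = π ≫ ψ`, `ψ⁻¹ U = U`, `ψ^* I = I`
and `ψ^* b = b`, then the preimage under the isomorphism `ψ'` of a principal chart for `(U, b)` is a principal chart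
for `(U, b)`. [OURS · L1 W4.5c] -/
theorem IsPrincipalChart.preimage {ψ' : X' ⟶ X'} [IsIso ψ'] {ψ : X ⟶ X} (hcomm : ψ' ≫ π = π ≫ ψ)
    (hU : ψ ⁻¹ᵁ (U : X.Opens) = U) (hI : I.comap ψ = I)
    (hb : ψ.appLE U U hU.ge b = b) {W : X'.affineOpens} (hW : IsPrincipalChart π I U b W) :
    IsPrincipalChart π I U b ⟨ψ' ⁻¹ᵁ (W : X'.Opens), W.2.preimage_of_isIso ψ'⟩ := by
  obtain ⟨hle, hnzd, hideal⟩ := hW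
  -- `ψ'⁻¹ W ≤ π⁻¹ U`
  have hle' : ψ' ⁻¹ᵁ (W : X'.Opens) ≤ π ⁻¹ᵁ (U : X.Opens) := by
    have h1 : ψ' ⁻¹ᵁ (W : X'.Opens) ≤ ψ' ⁻¹ᵁ (π ⁻¹ᵁ (U : X.Opens)) := fun x hx => hle hx
    have h2 : ψ' ⁻¹ᵁ (π ⁻¹ᵁ (U : X.Opens)) = π ⁻¹ᵁ (U : X.Opens) := by
      rw [← Scheme.Hom.comp_preimage, hcomm, Scheme.Hom.comp_preimage, hU]
    exact h1.trans h2.le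
  -- the comparison iso `Φ = ψ'.app W : Γ(W) ≅ Γ(ψ'⁻¹ W)` maps `π^* b|_W` to `π^* b|_{ψ'⁻¹ W}`
  have hΦ : ψ'.appLE W (ψ' ⁻¹ᵁ (W : X'.Opens)) le_rfl (π.appLE U W hle b) =
      π.appLE U (ψ' ⁻¹ᵁ (W : X'.Opens)) hle' b := by
    change (π.appLE U W hle ≫ ψ'.appLE W (ψ' ⁻¹ᵁ (W : X'.Opens)) le_rfl) b = _
    rw [Scheme.Hom.appLE_comp_appLE,
      appLE_congr_of_eq hcomm U (ψ' ⁻¹ᵁ (W : X'.Opens)) _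
        (hle'.trans (by rw [Scheme.Hom.comp_preimage, hU])),
      ← Scheme.Hom.appLE_comp_appLE π ψ U U (ψ' ⁻¹ᵁ (W : X'.Opens)) hU.ge hle']
    change π.appLE U (ψ' ⁻¹ᵁ (W : X'.Opens)) hle' (ψ.appLE U U hU.ge b) = _
    rw [hb]
  haveI : IsIso (ψ'.appLE W (ψ' ⁻¹ᵁ (W : X'.Opens)) le_rfl) := by
    rw [Scheme.Hom.appLE_eq_app]; infer_instance
  obtain ⟨Φ, hΦapply⟩ : ∃ Φ : Γ(X', W) ≃+* Γ(X', ψ' ⁻¹ᵁ (W : X'.Opens)),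
      ∀ s, Φ s = ψ'.appLE W (ψ' ⁻¹ᵁ (W : X'.Opens)) le_rfl s :=
    ⟨(asIso (ψ'.appLE W (ψ' ⁻¹ᵁ (W : X'.Opens)) le_rfl)).commRingCatIsoToRingEquiv, fun _ => rfl⟩
  have hΦb : Φ (π.appLE U W hle b) = π.appLE U (ψ' ⁻¹ᵁ (W : X'.Opens)) hle' b := by rw [hΦapply, hΦ]
  refine ⟨hle', ?_, ?_⟩
  · -- nonzerodivisor: transported along the ring isomorphism `Φ`
    rw [← hΦb, mem_nonZeroDivisors_iff_right]
    intro y hy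
    have : Φ.symm y * π.appLE U W hle b = 0 := by
      apply Φ.injective
      rw [map_mul, Φ.apply_symm_apply, map_zero, hy]
    have h0 := (mem_nonZeroDivisors_iff_right.mp hnzd) _ this
    simpa using congrArg Φ h0
  · -- the ideal: `(I·𝒪)(ψ'⁻¹ W) = Φ((I·𝒪)(W)) = (Φ (π^*b))`
    have hinv : (I.comap π).comap ψ' = I.comap π := by
      rw [← Scheme.IdealSheafData.comap_comp, hcomm, Scheme.IdealSheafData.comap_comp, hI]
    have key := ideal_comap_of_le ψ' (I.comap π) W ⟨ψ' ⁻¹ᵁ (W : X'.Opens), W.2.preimage_of_isIso ψ'⟩ le_rfl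
    rw [hinv] at key
    rw [key, hideal, Ideal.map_span, Set.image_singleton, ← hΦb, hΦapply]

/-- The preimage of the principal chart under `ψ'` lies in the principal chart. -/
theorem preimage_blowupChart_le {ψ' : X' ⟶ X'} [IsIso ψ'] {ψ : X ⟶ X} (hcomm : ψ' ≫ π = π ≫ ψ)
    (hU : ψ ⁻¹ᵁ (U : X.Opens) = U) (hI : I.comap ψ = I) (hb : ψ.appLE U U hU.ge b = b) :
    ψ' ⁻¹ᵁ blowupChart π I U b ≤ blowupChart π I U b := by
  intro x hx
  obtain ⟨W, hW, hxW⟩ := mem_blowupChart_iff.mp hx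
  exact mem_blowupChart_iff.mpr ⟨_, IsPrincipalChart.preimage hcomm hU hI hb hW, hxW⟩

/-- **(S3) STABILITY OF THE PRINCIPAL CHARTS**: an automorphism `θ'` of `X'` covering an automorphism `θ` of `X`
that fixes `U`, `I` and the section `b` preserves `blowupChart π I U b`. [OURS · L1 W4.5c] -/
theorem preimage_blowupChart_eq (θ' : X' ≅ X') (θ : X ≅ X) (hcomm : θ'.hom ≫ π = π ≫ θ.hom)
    (hU : θ.hom ⁻¹ᵁ (U : X.Opens) = U) (hI : I.comap θ.hom = I) (hb : θ.hom.appLE U U hU.ge b = b) :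
    θ'.hom ⁻¹ᵁ blowupChart π I U b = blowupChart π I U b := by
  -- the hypotheses for the inverse pair
  have hcomm' : θ'.inv ≫ π = π ≫ θ.inv := by
    rw [Iso.inv_comp_eq, ← Category.assoc, hcomm, Category.assoc, Iso.hom_inv_id, Category.comp_id]
  have hU' : θ.inv ⁻¹ᵁ (U : X.Opens) = U := by
    conv_lhs => rw [← hU]
    rw [← Scheme.Hom.comp_preimage, Iso.inv_hom_id, Scheme.Hom.id_preimage]
  have hI' : I.comap θ.inv = I := by
    conv_lhs => rw [← hI]
    rw [← Scheme.IdealSheafData.comap_comp, Iso.inv_hom_id, Scheme.IdealSheafData.comap_id]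
  have hb' : θ.inv.appLE U U hU'.ge b = b := by
    conv_lhs => rw [← hb]
    change (θ.hom.appLE U U hU.ge ≫ θ.inv.appLE U U hU'.ge) b = b
    rw [Scheme.Hom.appLE_comp_appLE,
      appLE_congr_of_eq θ.inv_hom_id U U _ (le_refl _)]
    exact id_appLE_apply (U : X.Opens) _ b
  apply le_antisymm (preimage_blowupChart_le hcomm hU hI hb)
  -- the other inclusion from the inverse
  intro x hx
  have hx' : θ'.inv (θ'.hom x) = x := by
    rw [← Scheme.Hom.comp_apply, Iso.hom_inv_id]; rfl
  have := preimage_blowupChart_le hcomm' hU' hI' hb' (x := θ'.hom x) (by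
    change θ'.inv (θ'.hom x) ∈ blowupChart π I U b
    rw [hx']; exact hx)
  exact this

end Summit.ResolutionOfSingularities.ResolutionOfSingularities.Theorems.WildQuotientResolution.S1.BlowupCharts

end
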